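import Literature.AlgebraicGeometry.ShimuraVarieties.UnitaryShimuraReciprocityFactorGlobal
import Literature.AlgebraicGeometry.ShimuraVarieties.UnitaryShimuraComplexFibreGalois
import HarnessLib

/-!
# The Shimura-reciprocity twist `[x, r_x(s)·aK]` is independent of the Artin correspondent `s`
# ([Milne 2005] Def. 12.8 (62) — part 2: the rational diagonal twist and the geometric statement)

Topic `AlgebraicGeometry/ShimuraVarieties`; namespace `Literature.AlgebraicGeometry.ShimuraVarieties`, grouping
sub-namespace `UnitaryCanonicalModel`.  THEOREMS ONLY.  Sequel of `…UnitaryShimuraReciprocityFactorGlobal` (for two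
Artin correspondents `s, s'` of one `σ`, `r(s)/r(s')` is a GLOBAL norm-one scalar `z ⊗ 1`).  Cell hodgecm-mathlib
(D-0151), fan A, KEY a1-reflex-compositum-model (idèle passage of stub (A)); HC_CM is proved only modulo the 7 printed
citations until rung 0 closes; nothing here touches them.

WHAT IS PROVED (`H ∈ M₃(L)` with a frame `T` of signature `(2,1)` at `τ` — hence hermitian —, `v₃` anisotropic,
`x ∈ 𝔹²` the CM point of the line `L·v₃`, `IsLinePoint`):
* §4 `exists_rational_isDiagTwist_algebraMap` — for `z ∈ L` with `z·c(z) = 1` the quasi-reflection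
  `γ_z = 1 + ((z-1)/⟨v₃,v₃⟩)·v₃ ⊗ ⟨v₃,·⟩` lies in `U(H)(L⁺)` (the tree's `rational`), its image in `U(H)(𝔸_{L⁺,f})` is THE
  diagonal twist by `z ⊗ 1` (`IsDiagTwist`; unique by `isDiagTwist_unique`) and it FIXES `x` (`T⁻¹ γ^τ T (x,1) = τ(z)·(x,1)`)
  — [Milne2005ShimuraVarieties] Def. 12.5: the special point is fixed by `T(ℚ) ∋ γ_z`;
  `shimuraSet_mk_mul_eq_of_isDiagTwist_algebraMap` — hence `[x, g·aK] = [x, aK]` for the twist `g` by a global norm-one `z`.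
* §5 **`shimuraSet_mk_twist_eq_of_isArtinCorrespondent`** — if `s, s'` are both Artin correspondents of `σ` and `d, d'` the
  diagonal twists by `r_x(s)`, `r_x(s')`, then `[x, d·aK] = [x, d'·aK]` in `Sh_K(ℂ)` for all `a`, `K`: the reciprocity law
  (62) «`σ[x,a] = [x, r_x(s)a]` for any `s` with `art(s) = σ`» is well posed, and a law proved for ONE correspondent
  (e.g. `N_{E♯/L} s̃`) holds for ALL (e.g. the `L`-idèle `s` of the hDel predicate `IsCanonicalDescentAt`).

References: [Milne2005ShimuraVarieties] Lemma 5.13 p. 57, Def. 12.5–Rem. 12.6 p. 113, Def. 12.8 (62) p. 114;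
[Shimura1998] §18.3 p. 122; [Deligne1979ShimuraVarieties] 2.2.4–2.2.5.
-/

set_option autoImplicit false

noncomputable section

open Function NumberField IsDedekindDomain Matrix
open scoped Matrix
open Literature.NumberTheory.Automorphic Literature.NumberTheory.Automorphic.UnitaryGroup
open Literature.NumberTheory.GaloisRepresentations
open Literature.NumberTheory.NumberFields
open Literature.Geometry.ComplexHyperbolic Literature.Geometry.ComplexHyperbolic.BallModel
open Literature.NumberTheory.Automorphic.Liu2021.AppendixC (C5.OpenCompactSubgroup C5.SmallLevel)

namespace Literature.AlgebraicGeometry.ShimuraVarieties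

namespace UnitaryCanonicalModel

variable (L : Type) [Field L] [NumberField L] [IsCMField L]

/-! ### §4. A diagonal twist by a GLOBAL norm-one scalar is a rational element of `U(H)(L⁺)` fixing the CM point -/

variable {L}

omit [NumberField L] [IsCMField L] in
/-- The action of a quasi-reflection `1 + a · u ⊗ r` on a vector: `x + a ⟨r, x⟩ u`. [folklore] -/
private theorem one_add_smul_vecMulVec_mulVec (u r : Fin 3 → L) (a : L) (x : Fin 3 → L) :
    (1 + a • vecMulVec u r) *ᵥ x = x + (a * (r ⬝ᵥ x)) • u := by
  rw [add_mulVec, one_mulVec, smul_mulVec, vecMulVec_mulVec]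
  ext i
  simp only [Pi.add_apply, Pi.smul_apply, MulOpposite.smul_eq_mul_unop, MulOpposite.unop_op, smul_eq_mul]
  ring

omit [NumberField L] [IsCMField L] in
/-- Composition of two quasi-reflections along one vector. [folklore] -/
private theorem one_add_smul_vecMulVec_mul (u r : Fin 3 → L) (a b : L) :
    (1 + a • vecMulVec u r) * (1 + b • vecMulVec u r) = 1 + (a + b + a * b * (r ⬝ᵥ u)) • vecMulVec u r := by
  rw [add_mul, one_mul, mul_add, mul_one, Matrix.smul_mul, Matrix.mul_smul, vecMulVec_mul_vecMulVec, vecMulVec_smul,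
    smul_smul, smul_smul]
  module

/-- **The rational diagonal twist**: for `H` hermitian, `⟨v₃,v₃⟩ ≠ 0` and `z ∈ L` with `z·c(z) = 1` there is
`γ ∈ U(H)(L⁺)` (the tree's `rational`) multiplying `v₃` by `z` and fixing `v₃^{⊥_H}` pointwise — the RATIONAL point
`γ = 1 + ((z-1)/⟨v₃,v₃⟩) v₃ ⊗ ⟨v₃,·⟩` of the torus `T₃` at the special point ([Milne2005ShimuraVarieties] Def. 12.5:
`T(ℚ)` fixes `x`).  Consequently its image in `U(H)(𝔸_{L⁺,f})` is THE diagonal twist by `z ⊗ 1` (`IsDiagTwist`,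
unique by `isDiagTwist_unique`) and it fixes the CM point `x` of the line `L·v₃` in the ball.
[cite: Milne2005ShimuraVarieties, Def. 12.5 and Rem. 12.6 p. 113] -/
theorem exists_rational_isDiagTwist_algebraMap (H : Matrix (Fin 3) (Fin 3) L) (τ : L →+* ℂ) (T : GL (Fin 3) ℂ)
    (hT : formCongr (starRingEnd ℂ) T (H.map τ) = BallModel.J) {v₃ : Fin 3 → L}
    (hv : hermForm (cmConjRingHom L) H v₃ v₃ ≠ 0) {z : L} (hz : z * cmConjRingHom L z = 1) {x : Ball}
    (hx : IsLinePoint L τ T v₃ x) :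
    ∃ γ : rational (↥(maximalRealSubfield L)) L (IsCMField.complexConj L) 3 H,
      IsDiagTwist L H v₃ (algebraMap L (FiniteAdeleRing (𝓞 L) L) z)
          (rationalToFinAdelic (↥(maximalRealSubfield L)) L (IsCMField.complexConj L) 3 H γ) ∧
        ratToU21 L H τ T hT γ • x = x := by
  have hH : ∀ i j, cmConjRingHom L (H i j) = H j i := cmConjRingHom_apply_eq_of_formCongr_eq_J L H τ T hT
  have hcc : ∀ y : L, cmConjRingHom L (cmConjRingHom L y) = y := fun y => by
    rw [cmConjRingHom_apply, cmConjRingHom_apply]; exact IsCMField.complexConj_apply_apply L y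
  -- notation: `h = ⟨v₃,v₃⟩`, the row `ρ = ⟨v₃, ·⟩`, the coefficients `a = (z-1)/h`, `a' = (c z - 1)/h`
  set h : L := hermForm (cmConjRingHom L) H v₃ v₃ with hh
  set ρ : Fin 3 → L := (cmConjRingHom L ∘ v₃) ᵥ* H with hρ
  have hρv : ρ ⬝ᵥ v₃ = h := by rw [hh, hρ]; exact (dotProduct_mulVec _ _ _).symm
  have hρw : ∀ w : Fin 3 → L, hermForm (cmConjRingHom L) H w v₃ = 0 → ρ ⬝ᵥ w = 0 := fun w hw => by
    rw [hρ, ← dotProduct_mulVec]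
    change hermForm (cmConjRingHom L) H v₃ w = 0
    rw [hermForm_comm H hH, hw, map_zero]
  have hch : cmConjRingHom L h = h := conj_hermForm_self H hH v₃
  set a : L := (z - 1) * h⁻¹ with ha
  set a' : L := (cmConjRingHom L z - 1) * h⁻¹ with ha'
  have hca : cmConjRingHom L a = a' := by rw [ha, ha', map_mul, map_sub, map_one, map_inv₀, hch]
  have hkey : a + a' + a * a' * h = 0 := by
    rw [ha, ha']
    field_simp
    linear_combination hz
  have hkey' : a' + a + a' * a * h = 0 := by linear_combination hkey
  set P : Matrix (Fin 3) (Fin 3) L := 1 + a • vecMulVec v₃ ρ with hP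
  set P' : Matrix (Fin 3) (Fin 3) L := 1 + a' • vecMulVec v₃ ρ with hP'
  have hPP' : P * P' = 1 := by
    rw [hP, hP', one_add_smul_vecMulVec_mul, hρv, hkey, zero_smul, add_zero]
  have hP'P : P' * P = 1 := by
    rw [hP, hP', one_add_smul_vecMulVec_mul, hρv, hkey', zero_smul, add_zero]
  -- action on `v₃` and on `v₃^⊥`
  have hPv : P *ᵥ v₃ = z • v₃ := by
    rw [hP, one_add_smul_vecMulVec_mulVec, hρv]
    have : a * h = z - 1 := by rw [ha]; field_simp
    rw [this]
    ext i
    simp only [Pi.add_apply, Pi.smul_apply, smul_eq_mul]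
    ring
  have hPw : ∀ w : Fin 3 → L, hermForm (cmConjRingHom L) H w v₃ = 0 → P *ᵥ w = w := fun w hw => by
    rw [hP, one_add_smul_vecMulVec_mulVec, hρw w hw, mul_zero, zero_smul, add_zero]
  -- unitarity `(c P)ᵀ H P = H`
  have hρc : ∀ j, cmConjRingHom L (ρ j) = (H *ᵥ v₃) j := fun j => by
    simp only [hρ, vecMul, dotProduct, Function.comp_apply, map_sum, map_mul, hcc, hH, mulVec]
    refine Finset.sum_congr rfl fun i _ => ?_
    ring
  have hPc : (P.map (cmConjRingHom L))ᵀ = 1 + a' • vecMulVec (H *ᵥ v₃) (cmConjRingHom L ∘ v₃) := by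
    rw [hP, Matrix.map_add _ (map_add _), Matrix.map_one _ (map_zero _) (map_one _), transpose_add,
      transpose_one]
    congr 1
    ext i j
    simp only [transpose_apply, Matrix.map_apply, Matrix.smul_apply, vecMulVec_apply, smul_eq_mul, map_mul, hca,
      hρc, Function.comp_apply]
    ring
  have hunit : (P.map (cmConjRingHom L))ᵀ * H * P = H := by
    rw [hPc, add_mul, one_mul, Matrix.smul_mul, vecMulVec_mul, ← hρ, hP]
    rw [mul_add, mul_one, Matrix.mul_smul, add_mul, Matrix.smul_mul, mul_vecMulVec, vecMulVec_mul_vecMulVec, hρv,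
      vecMulVec_smul]
    match_scalars
    · ring
    · linear_combination hkey
  -- the rational element
  let γ₀ : GL (Fin 3) L := ⟨P, P', hPP', hP'P⟩
  have hγ₀ : γ₀ ∈ rational (↥(maximalRealSubfield L)) L (IsCMField.complexConj L) 3 H := hunit
  refine ⟨⟨γ₀, hγ₀⟩, ⟨?_, fun w hw => ?_⟩, ?_⟩
  · -- `(P ⊗ 1)(v₃ ⊗ 1) = (z ⊗ 1)(v₃ ⊗ 1)`
    change (P.map (algebraMap L (FiniteAdeleRing (𝓞 L) L))) *ᵥ adelicVec L v₃ = _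
    funext i
    have h1 := (RingHom.map_mulVec (algebraMap L (FiniteAdeleRing (𝓞 L) L)) P v₃ i).symm
    rw [hPv] at h1
    change (P.map (algebraMap L (FiniteAdeleRing (𝓞 L) L)) *ᵥ
      ((algebraMap L (FiniteAdeleRing (𝓞 L) L)) ∘ v₃)) i = _
    rw [h1, Pi.smul_apply, Pi.smul_apply, smul_eq_mul, smul_eq_mul, map_mul]
    rfl
  · change (P.map (algebraMap L (FiniteAdeleRing (𝓞 L) L))) *ᵥ adelicVec L w = _
    funext i
    have h1 := (RingHom.map_mulVec (algebraMap L (FiniteAdeleRing (𝓞 L) L)) P w i).symm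
    rw [hPw w hw] at h1
    exact h1
  · -- `γ` fixes the CM point of `L·v₃`: `T⁻¹ γ^τ T (x,1) = τ(z) · (x,1)`
    obtain ⟨cx, hcx, hTx⟩ := hx
    have hz0 : z ≠ 0 := by
      rintro rfl
      rw [zero_mul] at hz
      exact zero_ne_one hz
    have hW : BallModel.W3 (ratToU21 L H τ T hT ⟨γ₀, hγ₀⟩) x = τ z • BallModel.lift x := by
      have hmat : BallModel.mat (ratToU21 L H τ T hT ⟨γ₀, hγ₀⟩) =
          ((T⁻¹ : GL (Fin 3) ℂ) : Matrix (Fin 3) (Fin 3) ℂ) * P.map τ * (T : Matrix (Fin 3) (Fin 3) ℂ) := by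
        change ((archProjU21EmbCM L H τ T hT (rationalToArch (↥(maximalRealSubfield L)) L
          (IsCMField.complexConj L) 3 H ⟨γ₀, hγ₀⟩) : U21) : GL (Fin 3) ℂ).val = _
        rw [coe_archProjU21EmbCM_rationalToArch, Units.val_mul, Units.val_mul]
        rfl
      have hPτ : P.map τ *ᵥ (fun i => τ (v₃ i)) = τ z • fun i => τ (v₃ i) := by
        funext i
        have h1 := (RingHom.map_mulVec τ P v₃ i).symm
        rw [hPv] at h1
        change (P.map τ *ᵥ (τ ∘ v₃)) i = _
        rw [h1, Pi.smul_apply, Pi.smul_apply, smul_eq_mul, smul_eq_mul, map_mul]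
      rw [BallModel.W3, hmat, ← mulVec_mulVec, ← mulVec_mulVec, hTx, mulVec_smul, hPτ, smul_comm, ← hTx,
        mulVec_smul, mulVec_mulVec, ← Units.val_mul, inv_mul_cancel, Units.val_one, one_mulVec]
    rw [BallModel.smul_def]
    apply Ball.ext
    intro i
    rw [BallModel.act_val, hW, Pi.smul_apply, Pi.smul_apply, smul_eq_mul, smul_eq_mul, BallModel.lift_2, mul_one,
      mul_div_cancel_left₀ _ ((map_ne_zero τ).2 hz0)]
    fin_cases i <;> rfl

/-- **A diagonal twist by a global norm-one scalar acts trivially on `Sh_K(ℂ)` at the CM point**: if `g ∈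
U(H)(𝔸_{L⁺,f})` twists `v₃` by `z ⊗ 1` with `z ∈ L`, `z·c(z) = 1`, then `[x, g·aK] = [x, aK]` for the CM point `x`
of `L·v₃`, every `a` and every level `K` — because `g = γ ⊗ 1` for the rational `γ ∈ T₃(ℚ) ⊆ U(H)(L⁺)` of
`exists_rational_isDiagTwist_algebraMap`, which fixes `x` (`[x, γ a K] = [γ⁻¹ x, aK]`).
[cite: Milne2005ShimuraVarieties, Def. 12.5 p. 113 and Lemma 5.13 p. 57] -/
theorem shimuraSet_mk_mul_eq_of_isDiagTwist_algebraMap (H : Matrix (Fin 3) (Fin 3) L) (τ : L →+* ℂ)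
    (T : GL (Fin 3) ℂ) (hT : formCongr (starRingEnd ℂ) T (H.map τ) = BallModel.J)
    (K : Subgroup (finAdelic (↥(maximalRealSubfield L)) L (IsCMField.complexConj L) 3 H)) {v₃ : Fin 3 → L}
    (hv : hermForm (cmConjRingHom L) H v₃ v₃ ≠ 0) {z : L} (hz : z * cmConjRingHom L z = 1) {x : Ball}
    (hx : IsLinePoint L τ T v₃ x) {g : finAdelic (↥(maximalRealSubfield L)) L (IsCMField.complexConj L) 3 H}
    (hg : IsDiagTwist L H v₃ (algebraMap L (FiniteAdeleRing (𝓞 L) L) z) g)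
    (a : finAdelic (↥(maximalRealSubfield L)) L (IsCMField.complexConj L) 3 H) :
    ShimuraSet.mk L H τ T hT K x (g * a) = ShimuraSet.mk L H τ T hT K x a := by
  obtain ⟨γ, hγ, hγx⟩ := exists_rational_isDiagTwist_algebraMap H τ T hT hv hz hx
  have hγg : rationalToFinAdelic (↥(maximalRealSubfield L)) L (IsCMField.complexConj L) 3 H γ = g :=
    isDiagTwist_unique L H hv hγ hg
  rw [ShimuraSet.mk_eq_mk_iff]
  refine ⟨γ, hγx, ?_⟩
  rw [hγg, inv_mul_cancel]
  exact K.one_mem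

/-! ### §5. The twist class is independent of the Artin correspondent -/

variable (L)

/-- **Shimura reciprocity's twist `[x, r_x(s)·aK]` depends only on `σ`, not on the chosen Artin correspondent `s`**:
if `s, s' ∈ (𝔸_{L,f})^×` both satisfy `art_L(·) = σ|_{L^{ab}}` (`IsArtinCorrespondent`) and `d, d'` are the diagonal
twists at the CM point `x` of `L·v₃` by `r_x(s) = c(s)/s`, `r_x(s') = c(s')/s'`, then `[x, d·aK] = [x, d'·aK]` in `Sh_K(ℂ)`
for every `a` and `K`.  Proof: `[(1,s), L] = [(1,s'), L]` (`ideleArtinMap_eq_of_isArtinCorrespondent`), so `k = s/s'` lies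
in `closure(L^×)` (`ker [·, L] = closure(L^× · L_∞^×)`, [Shimura1998] §18.3, tree
`ideleArtinMap_inr_eq_one_iff_mem_closure`), so `r_x(k) = z ⊗ 1` is a GLOBAL norm-one scalar (Kronecker,
`exists_recipFactor_eq_algebraMap_of_mem_closure`), and `d·d'⁻¹ = γ_z ⊗ 1` with `γ_z ∈ T₃(ℚ)` fixing `x`
(`shimuraSet_mk_mul_eq_of_isDiagTwist_algebraMap`).  This is the well-definedness of (62) implicit in
[Milne2005ShimuraVarieties] Def. 12.8 («for any `s` with `art(s) = σ`»); it converts reciprocity laws between different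
Artin correspondents (e.g. `N_{E♯/L} s̃` versus `s`). [cite: Milne2005ShimuraVarieties, Def. 12.8 (62) p. 114]
[cite: Shimura1998, §18.3 p. 122] -/
theorem shimuraSet_mk_twist_eq_of_isArtinCorrespondent (H : Matrix (Fin 3) (Fin 3) L) (τ : L →+* ℂ)
    (T : GL (Fin 3) ℂ) (hT : formCongr (starRingEnd ℂ) T (H.map τ) = BallModel.J)
    (K : Subgroup (finAdelic (↥(maximalRealSubfield L)) L (IsCMField.complexConj L) 3 H)) {σ : ℂ ≃+* ℂ}
    {s s' : (FiniteAdeleRing (𝓞 L) L)ˣ} (hs : IsArtinCorrespondent L τ s σ) (hs' : IsArtinCorrespondent L τ s' σ)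
    {v₃ : Fin 3 → L} (hv : hermForm (cmConjRingHom L) H v₃ v₃ ≠ 0) {x : Ball} (hx : IsLinePoint L τ T v₃ x)
    {d d' : finAdelic (↥(maximalRealSubfield L)) L (IsCMField.complexConj L) 3 H}
    (hd : IsDiagTwist L H v₃ (recipFactor L s) d) (hd' : IsDiagTwist L H v₃ (recipFactor L s') d')
    (a : finAdelic (↥(maximalRealSubfield L)) L (IsCMField.complexConj L) 3 H) :
    ShimuraSet.mk L H τ T hT K x (d * a) = ShimuraSet.mk L H τ T hT K x (d' * a) := by
  set ι : (FiniteAdeleRing (𝓞 L) L)ˣ →* ideleGroup L :=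
    Units.map (MonoidHom.inr (InfiniteAdeleRing L) (FiniteAdeleRing (𝓞 L) L) :
      FiniteAdeleRing (𝓞 L) L →* AdeleRing (𝓞 L) L) with hι
  -- `k = s/s'` is killed by the Artin map, hence lies in `closure(L^×)`
  have hk : ideleArtinMap L (ι (s * s'⁻¹)) = 1 := by
    have h1 : ι (s * s'⁻¹) = ι s * (ι s')⁻¹ := by rw [map_mul, map_inv]
    have h2 : ideleArtinMap L (ι s) = ideleArtinMap L (ι s') := ideleArtinMap_eq_of_isArtinCorrespondent L τ hs hs'
    rw [h1, (ideleArtinMap L).map_mul, (ideleArtinMap L).map_inv, h2, mul_inv_cancel]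
  have hcl := mem_closure_range_unitEmbedding_of_ideleArtinMap_eq_one L (s * s'⁻¹) hk
  -- so `r(k) = z ⊗ 1` with `z c(z) = 1`
  obtain ⟨z, hz, hzk⟩ := exists_recipFactor_eq_algebraMap_of_mem_closure L (s * s'⁻¹) hcl
  -- `d d'⁻¹` is the twist by `r(k)`
  have hdd : IsDiagTwist L H v₃ (algebraMap L (FiniteAdeleRing (𝓞 L) L) z) (d * d'⁻¹) := by
    rw [← hzk, recipFactor_mul_inv]
    exact hd.mul_inv H hd' (recipFactor_mul_conj s')
  have h := shimuraSet_mk_mul_eq_of_isDiagTwist_algebraMap H τ T hT K hv hz hx hdd (d' * a)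
  rwa [mul_assoc, inv_mul_cancel_left] at h


/-- The CM point condition makes `v₃` anisotropic: `IsLinePoint L τ T v₃ x ⇒ ⟨v₃,v₃⟩ ≠ 0` (`τ(v₃)` is a NEGATIVE vector of
`H^τ`; tree `not_isLinePoint_of_not_mem_negCone`, `hermForm_self_ne_zero_of_mem_negCone`).
[cite: Milne2005ShimuraVarieties, Def. 12.5 p. 113] -/
theorem hermForm_self_ne_zero_of_isLinePoint (H : Matrix (Fin 3) (Fin 3) L) (τ : L →+* ℂ) (T : GL (Fin 3) ℂ)
    (hT : formCongr (starRingEnd ℂ) T (H.map τ) = BallModel.J) {v₃ : Fin 3 → L} {x : Ball}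
    (hx : IsLinePoint L τ T v₃ x) : hermForm (cmConjRingHom L) H v₃ v₃ ≠ 0 := by
  have hneg : (fun i => τ (v₃ i)) ∈ negCone (H.map τ) := by
    by_contra h
    exact not_isLinePoint_of_not_mem_negCone L H τ T hT v₃ h x hx
  exact hermForm_self_ne_zero_of_mem_negCone hneg

/-- **Kernel-twist invariance, packaged** in the binder order of the hodgecm-mathlib B-I skeleton's hypothesis
`KernelTwistInvariance` (B1HeckeQuotientDescent v7 :705, consumed by `galoisLegDescentOver_general_of`): for every hDel
datum `(L, H, τ, T, hT)`, level `K ≤ K₀`, `σ`, Artin correspondents `s, s'` of `σ`, CM point `x` of `L·v₃`, twists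
`d, d'` by `r_x(s)`, `r_x(s')` and every `a`: `[x, d·a]_K = [x, d'·a]_K`.  (`⟨v₃,v₃⟩ ≠ 0` is derived from `IsLinePoint`.)
[cite: Milne2005ShimuraVarieties, Def. 12.8 (59)–(62) pp. 107–114] [cite: Shimura1998, §18.3 p. 122] -/
theorem kernelTwistInvariance (H : Matrix (Fin 3) (Fin 3) L) (τ : L →+* ℂ) (T : GL (Fin 3) ℂ)
    (hT : formCongr (starRingEnd ℂ) T (H.map τ) = BallModel.J)
    (K₀ : C5.OpenCompactSubgroup ↥(finAdelic (↥(maximalRealSubfield L)) L (IsCMField.complexConj L) 3 H))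
    (K : C5.SmallLevel K₀) (σ : ℂ ≃+* ℂ) (s s' : (FiniteAdeleRing (𝓞 L) L)ˣ)
    (hs : IsArtinCorrespondent L τ s σ) (hs' : IsArtinCorrespondent L τ s' σ) (v₃ : Fin 3 → L) (x : Ball)
    (hx : IsLinePoint L τ T v₃ x) (d d' : finAdelic (↥(maximalRealSubfield L)) L (IsCMField.complexConj L) 3 H)
    (hd : IsDiagTwist L H v₃ (recipFactor L s) d) (hd' : IsDiagTwist L H v₃ (recipFactor L s') d')
    (a : finAdelic (↥(maximalRealSubfield L)) L (IsCMField.complexConj L) 3 H) :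
    ShimuraSet.mk L H τ T hT K.1.1 x (d * a) = ShimuraSet.mk L H τ T hT K.1.1 x (d' * a) :=
  shimuraSet_mk_twist_eq_of_isArtinCorrespondent L H τ T hT K.1.1 hs hs'
    (hermForm_self_ne_zero_of_isLinePoint L H τ T hT hx) hx hd hd' a

end UnitaryCanonicalModel

end Literature.AlgebraicGeometry.ShimuraVarieties

end
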